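import Summits.CriticalPhenomena.Ising3DConformalLimit.Theorems.HyperoctahedralRPExistsScaleCovariantLimitBlockDefs
import Summits.CriticalPhenomena.Ising3DConformalLimit.Theorems.HyperoctahedralRPExistsScaleCovariantLimitIntConfigBounded
import Summits.CriticalPhenomena.Ising3DConformalLimit.Theorems.MoebiusLimitExists.Negative.AxisRatioRegularity
import HarnessLib

/-!
# De-smearing lattice lemmas (line `monotone-blocking-port` of crux `ExistsScaleCovariantLimit`,
stmt-CriticalPhenomena-1981; auxiliary module of stub `stub_intMesh_of_blockLimits`, registered sub-goal
`intMesh_desmear_aux`)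

The `m`-independent lattice bookkeeping behind the de-smearing step S5 (`Sig.stub_intMesh_of_blockLimits`:
`BlockLimits → TwoPointScaling → UniformRegularity → IntMeshConvergence`). Write
`g(m) = ⟨σ₀σ_{m e₀}⟩_{β_c}`, `V(L) = C(L;0)` (`blockCov L 0`), `R_n(L;k⃗)` (`critBlockMoment`). For a mesh `1/m`,
a block side `L` and block offsets `k⃗ ∈ (ℤ³)ⁿ`, the BLOCK CONFIGURATIONS are the points of `(ℝ³)ⁿ` with
coordinates `(xᵢ + L kᵢ)/m`, `xᵢ ∈ cube L`.

* `latticeApprox_toLp_intCast_div`: at mesh `1/m` the lattice approximation of the point `w/m`, `w ∈ ℤ³`, is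
  EXACTLY `w` (no sawtooth at integer meshes).
* `sum_rescaledCorrelator_blockConfig` (THE DE-SMEARING IDENTITY, `n = 2p`): the sum over the block
  configurations of the pinned zoom `ρ_pin(1/m)^{2p} ⟨∏σ_{[·m]}⟩_{β_c}` equals
  `(L³)^{2p} · R_{2p}(L; k⃗) · (V(L)/(L⁶ g(m)))^p` (`ρ_pin(1/m)² = g(m)⁻¹`, `rhoPin_sq`; the numerator of
  `R_{2p}` is `R_{2p} · V^p` since `V(L) > 0` for `L ≥ 1`).
* `dist_blockConfig_lt`: with `L = ⌊m/j⌋` and offsets `j zᵢ`, every block configuration is within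
  `2(1/j + j Z/m)` (sup over `i` of Euclidean distances; `Z = max |zᵢₖ|`) of the integer configuration `z`.
* `tendsto_criticalTwoPoint_axis_floor_ratio`: `g(j⌊m/j⌋)/g(m) → 1`, a squeeze between `1` and
  `g(M + j)/g(M) → 1`, `M = j⌊m/j⌋` (the tree's `criticalTwoPoint_axis_ratio_shift_tendsto_one`), using
  `criticalTwoPoint_axis_antitone`.
* `tendsto_blockCov_div_of_twoPointScaling`: under `TwoPointScaling`, `V(⌊m/j⌋)/(⌊m/j⌋⁶ g(m))` converges
  (`= [V(L)/(L⁶g(L))]·[g(L)/g(jL)]·[g(jL)/g(m)] → Φ⁻¹ r_j⁻¹`).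

References: folklore bookkeeping; A. Messager, S. Miracle-Solé, J. Stat. Phys. 17 (1977) (axis monotonicity,
tree `criticalTwoPoint_axis_antitone`); M. Aizenman, H. Duminil-Copin, Ann. Math. 194 (2021) Prop. 5.9 (axis
ratio regularity, tree `AxisRatioRegularity.criticalTwoPoint_axis_ratio_shift_tendsto_one`). No definitions are
introduced.
-/

noncomputable section

namespace Summit.CriticalPhenomena.Ising3DConformalLimit.Cruxes.ExistsScaleCovariantLimit.MonotoneBlockingPort

open Literature.Probability.LatticeModels Filter Set Finset
open scoped Topology BigOperators
open Summit.CriticalPhenomena.Ising3DConformalLimit.MoebiusLimitExistsOnlyInteraction (rhoPin rhoPin_sq)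
open Summit.CriticalPhenomena.Ising3DConformalLimit.AxisRatioRegularity
  (criticalTwoPoint_axis_ratio_shift_tendsto_one)

/-! ### Positivity of the block variance -/

/-- `V(L) > 0` for `L ≥ 1`: every term `⟨σ_xσ_y⟩_{β_c}` is `≥ 0` (Griffiths) and the diagonal term at
`x = y = 0` is `⟨σ₀σ₀⟩ = 1`. [folklore] -/
private theorem desmear_blockCov_pos {L : ℕ} (hL : 1 ≤ L) : 0 < blockCov L 0 := by
  have h0 : (0 : Site 3) ∈ cube L := mem_cube.2 fun _ => ⟨le_rfl, by rw [Pi.zero_apply]; omega⟩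
  rw [blockCov_zero_eq]
  refine Finset.sum_pos' (fun x _ => Finset.sum_nonneg fun y _ => criticalTwoPoint_nonneg' _) ⟨0, h0, ?_⟩
  refine Finset.sum_pos' (fun y _ => criticalTwoPoint_nonneg' _) ⟨0, h0, ?_⟩
  rw [sub_zero, criticalTwoPoint_zero']
  exact one_pos

/-! ### Exactness of the lattice approximation at mesh `1/m` -/

/-- At mesh `1/m`, `m ≥ 1`, the lattice approximation of the point `w/m ∈ ℝ³`, `w ∈ ℤ³`, is exactly `w`:
`⌊(w_k/m)/(1/m)⌋ = w_k`. [folklore] -/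
theorem latticeApprox_toLp_intCast_div {m : ℕ} (hm : m ≠ 0) (w : Site 3) :
    latticeApprox (1 / (m : ℝ))
      (WithLp.toLp 2 fun k => ((w k : ℤ) : ℝ) / (m : ℝ) : EuclideanSpace ℝ (Fin 3)) = w := by
  funext k
  have hm' : (m : ℝ) ≠ 0 := Nat.cast_ne_zero.2 hm
  rw [latticeApprox_apply, PiLp.toLp_apply, div_div_eq_mul_div, div_one, div_mul_cancel₀ _ hm',
    Int.floor_intCast]

/-! ### The de-smearing identity -/

/-- **The de-smearing identity** (`n = 2p`, `L ≥ 1`, `m ≥ 1`, offsets `k⃗`): summing the pinned zoom at mesh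
`1/m` over the block configurations `((xᵢ + L kᵢ)/m)ᵢ`, `xᵢ ∈ cube L`, gives
`(L³)^{2p} · R_{2p}(L; k⃗) · (V(L)/(L⁶ g(m)))^p`: the lattice approximation is exact
(`latticeApprox_toLp_intCast_div`), `ρ_pin(1/m)^{2p} = g(m)^{-p}` (`rhoPin_sq`), and the numerator of the
block moment is `R_{2p}(L;k⃗) V(L)^p` (`V(L) > 0`). [folklore] -/
theorem sum_rescaledCorrelator_blockConfig {p L m : ℕ} (hL : 1 ≤ L) (hm : m ≠ 0)
    (k : Fin (2 * p) → Site 3) :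
    ∑ x ∈ Fintype.piFinset (fun _ : Fin (2 * p) => cube L),
        rescaledCorrelator (criticalCorr 3) rhoPin (2 * p) (1 / (m : ℝ))
          (fun i => (WithLp.toLp 2 fun k' => (((x i + (L : ℤ) • k i) k' : ℤ) : ℝ) / (m : ℝ) :
            EuclideanSpace ℝ (Fin 3))) =
      ((L : ℝ) ^ 3) ^ (2 * p) * (critBlockMoment (2 * p) L k *
        (blockCov L 0 / ((L : ℝ) ^ 6 * criticalTwoPoint 3 (Pi.single 0 (m : ℤ)))) ^ p) := by
  have hV := desmear_blockCov_pos hL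
  have hg : 0 < criticalTwoPoint 3 (Pi.single 0 (m : ℤ)) := criticalTwoPoint_axis_pos m
  have hLpos : (0 : ℝ) < L := by exact_mod_cast hL
  -- each summand: exact lattice approximation and `ρ_pin(1/m)^{2p} = g(m)^{-p}`
  have hterm : ∀ x : Fin (2 * p) → Site 3,
      rescaledCorrelator (criticalCorr 3) rhoPin (2 * p) (1 / (m : ℝ))
          (fun i => (WithLp.toLp 2 fun k' => (((x i + (L : ℤ) • k i) k' : ℤ) : ℝ) / (m : ℝ) :
            EuclideanSpace ℝ (Fin 3))) =
        (criticalTwoPoint 3 (Pi.single 0 (m : ℤ)))⁻¹ ^ p *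
          criticalCorr 3 (2 * p) (fun i => x i + (L : ℤ) • k i) := by
    intro x
    rw [rescaledCorrelator_apply, pow_mul, rhoPin_sq, one_div_one_div, Int.floor_natCast]
    have hcfg : (fun i => latticeApprox (1 / (m : ℝ))
        (WithLp.toLp 2 fun k' => (((x i + (L : ℤ) • k i) k' : ℤ) : ℝ) / (m : ℝ) :
          EuclideanSpace ℝ (Fin 3))) = fun i => x i + (L : ℤ) • k i :=
      funext fun i => latticeApprox_toLp_intCast_div hm _
    rw [hcfg]
  rw [Finset.sum_congr rfl fun x _ => hterm x, ← Finset.mul_sum]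
  -- the numerator of the block moment
  have hpow : blockCov L 0 ^ (((2 * p : ℕ) : ℝ) / 2) = blockCov L 0 ^ p := by
    rw [Nat.cast_mul, Nat.cast_ofNat, mul_div_cancel_left₀ _ (two_ne_zero' ℝ), Real.rpow_natCast]
  have hnum : ∑ x ∈ Fintype.piFinset (fun _ : Fin (2 * p) => cube L),
      criticalCorr 3 (2 * p) (fun i => x i + (L : ℤ) • k i) =
        critBlockMoment (2 * p) L k * blockCov L 0 ^ p := by
    rw [critBlockMoment, hpow, div_mul_cancel₀ _ (pow_ne_zero _ hV.ne')]
  rw [hnum, div_pow, mul_pow, inv_pow, ← pow_mul, show 3 * (2 * p) = 6 * p by ring, pow_mul]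
  field_simp

/-! ### The block configurations are close to the integer configuration -/

/-- **Distance bound.** Let `y ∈ (ℝ³)ⁿ` have integer coordinates `z` with `|zᵢₖ| ≤ Z`, `j ≥ 1`, `m ≥ 1`,
`L = ⌊m/j⌋`. For `xᵢ ∈ cube L` the block configuration `((xᵢ + L j zᵢ)/m)ᵢ` is within `2(1/j + jZ/m)` of `y`
(sup over `i` of Euclidean distances): coordinatewise `|xᵢₖ + (jL − m) zᵢₖ|/m ≤ (L + jZ)/m ≤ 1/j + jZ/m`, and
`√3 < 2`. [folklore] -/
theorem dist_blockConfig_lt {n : ℕ} {y : Fin n → EuclideanSpace ℝ (Fin 3)} {z : Fin n → Site 3}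
    (hz : ∀ i k, y i k = (z i k : ℝ)) {Z : ℕ} (hZ : ∀ i k, (z i k).natAbs ≤ Z) {j m : ℕ} (hj : 0 < j)
    (hm : 0 < m) {r : ℝ} (hr : 2 * (1 / (j : ℝ) + (j : ℝ) * Z / (m : ℝ)) < r) {x : Fin n → Site 3}
    (hx : x ∈ Fintype.piFinset fun _ : Fin n => cube (m / j)) :
    dist (fun i => (WithLp.toLp 2 fun k' =>
      (((x i + ((m / j : ℕ) : ℤ) • ((j : ℤ) • z i)) k' : ℤ) : ℝ) / (m : ℝ) : EuclideanSpace ℝ (Fin 3))) y < r := by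
  obtain ⟨L, ρ, hρ, rfl⟩ : ∃ L ρ : ℕ, ρ < j ∧ m = j * L + ρ :=
    ⟨m / j, m % j, Nat.mod_lt _ hj, (Nat.div_add_mod m j).symm⟩
  have hdiv : (j * L + ρ) / j = L := by
    rw [Nat.add_comm, Nat.add_mul_div_left _ _ hj, Nat.div_eq_of_lt hρ, Nat.zero_add]
  rw [hdiv] at hx ⊢
  set B : ℝ := 1 / (j : ℝ) + (j : ℝ) * Z / ((j * L + ρ : ℕ) : ℝ) with hB
  have hB0 : 0 ≤ B := by positivity
  have hr0 : 0 < r := lt_of_le_of_lt (by positivity) hr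
  have hmR : (0 : ℝ) < ((j * L + ρ : ℕ) : ℝ) := by exact_mod_cast hm
  have hjR : (0 : ℝ) < j := by exact_mod_cast hj
  -- coordinatewise bound
  have hcoord : ∀ i k',
      |(((x i + (L : ℤ) • ((j : ℤ) • z i)) k' : ℤ) : ℝ) / ((j * L + ρ : ℕ) : ℝ) - y i k'| ≤ B := by
    intro i k'
    obtain ⟨h0, hlt⟩ := mem_cube.1 (Fintype.mem_piFinset.1 hx i) k'
    have ha0 : (0 : ℝ) ≤ x i k' := by exact_mod_cast h0
    have haL : (x i k' : ℝ) < L := by exact_mod_cast hlt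
    have hcZ : |(z i k' : ℝ)| ≤ Z := by
      have h1 : |z i k'| ≤ (Z : ℤ) := by rw [Int.abs_eq_natAbs]; exact_mod_cast hZ i k'
      exact_mod_cast h1
    have hρR : (ρ : ℝ) ≤ j := by exact_mod_cast hρ.le
    have key : (((x i + (L : ℤ) • ((j : ℤ) • z i)) k' : ℤ) : ℝ) / ((j * L + ρ : ℕ) : ℝ) - y i k' =
        ((x i k' : ℝ) - (ρ : ℝ) * (z i k' : ℝ)) / ((j * L + ρ : ℕ) : ℝ) := by
      rw [hz i k', eq_div_iff hmR.ne', sub_mul, div_mul_cancel₀ _ hmR.ne']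
      simp only [Pi.add_apply, Pi.smul_apply, smul_eq_mul]
      push_cast
      ring
    rw [key, abs_div, abs_of_pos hmR, div_le_iff₀ hmR]
    calc |(x i k' : ℝ) - (ρ : ℝ) * (z i k' : ℝ)|
        ≤ |(x i k' : ℝ)| + |(ρ : ℝ) * (z i k' : ℝ)| := abs_sub _ _
      _ = (x i k' : ℝ) + (ρ : ℝ) * |(z i k' : ℝ)| := by
          rw [abs_of_nonneg ha0, abs_mul, abs_of_nonneg (Nat.cast_nonneg ρ)]
      _ ≤ (L : ℝ) + (j : ℝ) * Z := by gcongr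
      _ ≤ B * ((j * L + ρ : ℕ) : ℝ) := by
          have h2 : B * ((j * L + ρ : ℕ) : ℝ) = ((j * L + ρ : ℕ) : ℝ) / j + (j : ℝ) * Z := by
            rw [hB]
            field_simp
          have h3 : (L : ℝ) ≤ ((j * L + ρ : ℕ) : ℝ) / j := by
            rw [le_div_iff₀ hjR]
            push_cast
            nlinarith [Nat.cast_nonneg (α := ℝ) ρ]
          rw [h2]
          linarith
  -- sup over `i` of the Euclidean distances
  refine (dist_pi_lt_iff hr0).2 fun i => ?_
  rw [EuclideanSpace.dist_eq, Real.sqrt_lt' hr0]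
  calc ∑ k', dist ((WithLp.toLp 2 fun k' =>
          (((x i + (L : ℤ) • ((j : ℤ) • z i)) k' : ℤ) : ℝ) / ((j * L + ρ : ℕ) : ℝ) :
            EuclideanSpace ℝ (Fin 3)) k') (y i k') ^ 2
      ≤ ∑ _k' : Fin 3, B ^ 2 := Finset.sum_le_sum fun k' _ => by
          rw [PiLp.toLp_apply, Real.dist_eq]
          exact pow_le_pow_left₀ (abs_nonneg _) (hcoord i k') 2
    _ = 3 * B ^ 2 := by simp
    _ < r ^ 2 := by nlinarith

/-! ### The floor axis ratio `g(j⌊m/j⌋)/g(m) → 1` -/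

/-- `g(j⌊m/j⌋)/g(m) → 1` as `m → ∞` (`j ≥ 1`): `j⌊m/j⌋ ≤ m < j⌊m/j⌋ + j` and `g` is antitone along the axis
(`criticalTwoPoint_axis_antitone`), so `g(M+j)/g(M) ≤ g(m)/g(M) ≤ 1` with `M = j⌊m/j⌋ → ∞`; squeeze with
the tree's `criticalTwoPoint_axis_ratio_shift_tendsto_one`. [folklore] -/
theorem tendsto_criticalTwoPoint_axis_floor_ratio {j : ℕ} (hj : 0 < j) :
    Tendsto (fun m : ℕ => criticalTwoPoint 3 (Pi.single 0 ((j * (m / j) : ℕ) : ℤ)) /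
      criticalTwoPoint 3 (Pi.single 0 (m : ℤ))) atTop (𝓝 1) := by
  have hgpos : ∀ n : ℕ, 0 < criticalTwoPoint 3 (Pi.single 0 (n : ℤ)) := criticalTwoPoint_axis_pos
  have hanti := criticalTwoPoint_axis_antitone
  have hM : Tendsto (fun m : ℕ => j * (m / j)) atTop atTop := by
    refine tendsto_atTop_mono (fun m => ?_) (tendsto_sub_atTop_nat (j - 1))
    have h1 := Nat.div_add_mod m j
    have h2 := Nat.mod_lt m hj
    omega
  have hlow : Tendsto (fun m : ℕ => criticalTwoPoint 3 (Pi.single 0 ((j * (m / j) + j : ℕ) : ℤ)) /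
      criticalTwoPoint 3 (Pi.single 0 ((j * (m / j) : ℕ) : ℤ))) atTop (𝓝 1) :=
    (criticalTwoPoint_axis_ratio_shift_tendsto_one j).comp hM
  have hmid : Tendsto (fun m : ℕ => criticalTwoPoint 3 (Pi.single 0 (m : ℤ)) /
      criticalTwoPoint 3 (Pi.single 0 ((j * (m / j) : ℕ) : ℤ))) atTop (𝓝 1) := by
    refine tendsto_of_tendsto_of_tendsto_of_le_of_le hlow tendsto_const_nhds (fun m => ?_) (fun m => ?_)
    · refine div_le_div_of_nonneg_right (hanti ?_) (hgpos _).le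
      have h1 := Nat.div_add_mod m j
      have h2 := Nat.mod_lt m hj
      omega
    · exact (div_le_one (hgpos _)).2 (hanti (Nat.mul_div_le m j))
  have h := hmid.inv₀ one_ne_zero
  simpa only [inv_div, inv_one] using h

/-! ### The block-variance ratio converges under `TwoPointScaling` -/

/-- Under `TwoPointScaling` ((i) `L⁶g(L)/V(L) → Φ > 0`, (ii) `g(jL)/g(L) → r_j > 0`), for every `j ≥ 1` the ratio
`V(⌊m/j⌋)/(⌊m/j⌋⁶ g(m))` converges as `m → ∞` (to `Φ⁻¹ r_j⁻¹`): it is the product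
`[V(L)/(L⁶g(L))]·[g(L)/g(jL)]·[g(jL)/g(m)]`, `L = ⌊m/j⌋`, whose last factor `→ 1`
(`tendsto_criticalTwoPoint_axis_floor_ratio`). [folklore] -/
theorem tendsto_blockCov_div_of_twoPointScaling (hTS : TwoPointScaling) {j : ℕ} (hj : 0 < j) :
    ∃ c : ℝ, Tendsto (fun m : ℕ => blockCov (m / j) 0 /
      (((m / j : ℕ) : ℝ) ^ 6 * criticalTwoPoint 3 (Pi.single 0 (m : ℤ)))) atTop (𝓝 c) := by
  obtain ⟨⟨Φ, hΦ, hφ⟩, hratio⟩ := hTS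
  obtain ⟨r, hr, hψ⟩ := hratio j (Nat.succ_le_of_lt hj)
  have hL : Tendsto (fun m : ℕ => m / j) atTop atTop := Nat.tendsto_div_const_atTop hj.ne'
  have h1 := (hφ.comp hL).inv₀ hΦ.ne'
  have h2 := (hψ.comp hL).inv₀ hr.ne'
  have h3 := tendsto_criticalTwoPoint_axis_floor_ratio hj
  refine ⟨Φ⁻¹ * r⁻¹ * 1, ((h1.mul h2).mul h3).congr' ?_⟩
  filter_upwards [eventually_ge_atTop j] with m hm
  have hL1 : 1 ≤ m / j := (Nat.le_div_iff_mul_le hj).2 (by simpa using hm)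
  have hLpos : (0 : ℝ) < ((m / j : ℕ) : ℝ) := by exact_mod_cast hL1
  have hg1 := criticalTwoPoint_axis_pos (m / j)
  have hg2 := criticalTwoPoint_axis_pos (j * (m / j))
  have hg3 := criticalTwoPoint_axis_pos m
  have hV := desmear_blockCov_pos hL1
  simp only [Function.comp_apply]
  field_simp

/-! ### The registered sub-goal -/

/-- **Registered sub-goal `intMesh_desmear_aux`** (package of the de-smearing lattice lemmas used by stub
`stub_intMesh_of_blockLimits`): the de-smearing identity, the floor axis ratio `g(j⌊m/j⌋)/g(m) → 1`, and
convergence of `V(⌊m/j⌋)/(⌊m/j⌋⁶ g(m))` under `TwoPointScaling`. [folklore] -/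
theorem intMesh_desmear_aux :
    (∀ (p L m : ℕ) (k : Fin (2 * p) → Site 3), 1 ≤ L → m ≠ 0 →
      ∑ x ∈ Fintype.piFinset (fun _ : Fin (2 * p) => cube L),
          rescaledCorrelator (criticalCorr 3) rhoPin (2 * p) (1 / (m : ℝ))
            (fun i => (WithLp.toLp 2 fun k' => (((x i + (L : ℤ) • k i) k' : ℤ) : ℝ) / (m : ℝ) :
              EuclideanSpace ℝ (Fin 3))) =
        ((L : ℝ) ^ 3) ^ (2 * p) * (critBlockMoment (2 * p) L k *
          (blockCov L 0 / ((L : ℝ) ^ 6 * criticalTwoPoint 3 (Pi.single 0 (m : ℤ)))) ^ p)) ∧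
    (∀ j : ℕ, 0 < j → Tendsto (fun m : ℕ => criticalTwoPoint 3 (Pi.single 0 ((j * (m / j) : ℕ) : ℤ)) /
      criticalTwoPoint 3 (Pi.single 0 (m : ℤ))) atTop (𝓝 1)) ∧
    (TwoPointScaling → ∀ j : ℕ, 0 < j → ∃ c : ℝ, Tendsto (fun m : ℕ => blockCov (m / j) 0 /
      (((m / j : ℕ) : ℝ) ^ 6 * criticalTwoPoint 3 (Pi.single 0 (m : ℤ)))) atTop (𝓝 c)) :=
  ⟨fun _ _ _ k hL hm => sum_rescaledCorrelator_blockConfig hL hm k,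
    fun _ hj => tendsto_criticalTwoPoint_axis_floor_ratio hj,
    fun hTS _ hj => tendsto_blockCov_div_of_twoPointScaling hTS hj⟩

end Summit.CriticalPhenomena.Ising3DConformalLimit.Cruxes.ExistsScaleCovariantLimit.MonotoneBlockingPort

end
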